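import Literature.IUT.HodgeArakelov.GMonoidFrobenioidsOverBase
import Literature.IUT.HodgeArakelov.GroupTheoreticThetaMonoids
import HarnessLib

/-!
# [IUTchII] Prop 3.4 (i)(ii) / Cor 3.7 (i) at the Frobenioid level: an isomorphism of theta-environment data
# `M^Θ_*(Π_v) ⥲ M^Θ_*(†F_v)` induces EQUIVALENCES of the Def 3.8 Frobenioids `F_cns`, `F^ι_env` over the induced base equivalence

S. Mochizuki, *Inter-universal Teichmüller theory II*, §3, kurims manuscript (Dec. 2020): Prop 3.4 (i) p. 91 l. 20 – p. 92
l. 10 «each isomorphism of projective systems of mono-theta environments `M^Θ_*(Π_v) ⥲ M^Θ_*(†F_v)` induces compatible collections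
of isomorphisms `Π_X(M^Θ_*(Π_v)) ⥲ Π_X(M^Θ_*(†F_v))`, `Ψ_env(M^Θ_*(Π_v)) ⥲ Ψ_env(M^Θ_*(†F_v))` … the left-hand square arises
from the functoriality of the algorithms involved», (ii) p. 92 (the constant monoids `Ψ_cns`); Cor 3.7 (i) p. 111; Def 3.8
(i)(ii) p. 112–114 («the isomorphism of monoids … may be interpreted as an isomorphism of Frobenioids»; `F_cns(M^Θ_*)`,
`F^ι_env(M^Θ_*)`) [cite: Mochizuki2012, Prop 3.4 (i) p.91] (pages = kurims preprint render IUTchII-kurims-url-5036b4059555;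
D-0012 claim key, status disputed — nothing of the series is asserted).  [FrdI] Cor. 5.4 p. 104 [cite: MochizukiFrdI2008, Cor. 5.4 p.104].

abc-iut cell, MERGE-MAP register row **R-Def38-a**, item «ISO-AT-THETAENV» (plan/L6/MERGE-MAP.md §8S), seat abc-iut-L6-t7
gen 5.  PROOF-ONLY (0 `def`, 0 `instance`, 0 `Prop`-definition): existence of the Frobenioid-level equivalences, over abc-iut-L6-t2's
value-level `ThetaEnvData` (p404874) and its isomorphisms `ThetaEnvData.Iso` (`GroupTheoreticThetaMonoids`, p412316:
`phi : P ≃* P'`, `e : H ≃* H'`, `iota`, `map_conj`, and the PROVED transports `Iso.map_constantMonoid`, `Iso.map_thetaMonoid`,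
`Iso.isConjStable_map`), through THIS seat's base-changing functoriality `CoveringMonoid.frobenioidMapOfPairIso` /
`frobenioidMapOfPairIso_isEquivalence` (p468022) applied to the Def 3.8 `G`-monoids `ThetaEnvData.constantCovering` /
`coveringOfStable` (p457393).  The topologies on `Π_X(M^Θ_*(Π_v))`, `Π_X(M^Θ_*(†F_v))` and the continuity of print's group
isomorphism are INPUTS (`σ : P ≃ₜ* P'` with `σ = I.phi` pointwise): `ThetaEnvData` carries no topology.

* `exists_Fcns_equivalence_of_iso` — `F_cns(M^Θ_*(Π_v)) ≌ F_cns(M^Θ_*(†F_v))` by a functor lying over the base equivalence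
  `𝓑(Π_X(M^Θ_*(Π_v)))⁰ → 𝓑(Π_X(M^Θ_*(†F_v)))⁰` induced by `σ` ON THE NOSE (Prop 3.4 (ii) / Def 3.8 (i));
* `exists_frobenioidOfStable_equivalence_of_iso` — for a subgroup `Q` (print's stabiliser `G_v(M^Θ_*▶)`) acting on the theta
  monoid `Ψ^ι_env`, `F^ι_env(M^Θ_*(Π_v)) ≌ F^{ι'}_env(M^Θ_*(†F_v))` over `𝓑(Q)⁰ → 𝓑(σ(Q))⁰` (Prop 3.4 (i) / Def 3.8 (ii)), and the same
  for ANY `Q`-stable submonoid `S` carried by `I.e` onto `S'` (`exists_frobenioidOfStable_equivalence_of_map_eq`).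
HONEST LIMITS: (1) the «compatibility» squares of Prop 3.4 (i) with the evaluation/Kummer isomorphisms (Cor 3.5/3.6) are not
restated here (abc-iut-w4-d019's monoid-level `cor37_i_square/_chain`, p446415); (2) the isomorphism of projective systems of
mono-theta environments itself is abc-iut-L6-t2's INPUT `ThetaEnvData.Iso`; (3) existence statements (the functors are
`frobenioidMapOfPairIso` of explicit data, named in the proofs).  No sorry; typed ≠ proved elsewhere; nothing here bears on
[IUTchIII] Cor. 3.12; nothing asserts abc proved or refuted.
-/

noncomputable section

namespace Literature.IUT.HodgeArakelov

open CategoryTheory Opposite Function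
open Literature.AlgebraicGeometry.Frobenioids Literature.AnabelianGeometry.SemiGraphs

universe u v

namespace TemperedThetaMonoids.ThetaEnvData.Iso

variable {P P' : Type u} [Group P] [Group P'] [TopologicalSpace P] [TopologicalSpace P']
  {E : ThetaEnvData.{u, v} P} {E' : ThetaEnvData.{u, v} P'} (I : E.Iso E')
  (σ : P ≃ₜ* P') (hσ : ∀ g : P, σ g = I.phi g)

/-! ### 1. A submonoid carried by `I.e` onto another gives an equivariant isomorphism of the cut-out monoids -/

omit [TopologicalSpace P] [TopologicalSpace P'] in
/-- The isomorphism `S ≃* S'` of submonoids induced by `I.e` when `S.map I.e = S'` (e.g. `Ψ_cns ⥲ Ψ_cns`, `Ψ^ι_env ⥲ Ψ^{ι'}_env`: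
abc-iut-L6-t2's `Iso.map_constantMonoid`, `Iso.map_thetaMonoid`), as a bare statement of existence with its defining property.
[cite: Mochizuki2012, Prop 3.4 (i) p.91] -/
theorem exists_submonoidEquiv_of_map_eq {S : Submonoid E.H} {S' : Submonoid E'.H}
    (hmap : S.map (I.e : E.H →* E'.H) = S') :
    ∃ ψ : S ≃* S', ∀ x : S, (ψ x : E'.H) = I.e x :=
  ⟨(I.e.submonoidMap S).trans (MulEquiv.submonoidCongr hmap), fun _ => rfl⟩

/-! ### 2. `F_cns(M^Θ_*(Π_v)) ≌ F_cns(M^Θ_*(†F_v))` over the induced base equivalence (Prop 3.4 (ii) / Def 3.8 (i)) -/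

include hσ in
/-- **`F_cns` along an isomorphism of theta-environment data**: for `I : M^Θ_*(Π_v) ⥲ M^Θ_*(†F_v)` (abc-iut-L6-t2's
`ThetaEnvData.Iso`) and a topological refinement `σ` of its group isomorphism, there is a functor
`F_cns(M^Θ_*(Π_v)) ⥤ F_cns(M^Θ_*(†F_v))` (THIS seat's `frobenioidMapOfPairIso` of the pair isomorphism `(σ, I.e|_{Ψ_cns})`) which is
an EQUIVALENCE of categories and lies over the base change `𝓑(Π_X)⁰ → 𝓑(Π_X')⁰`, `U ↦ σ(U)`, ON THE NOSE.
[cite: Mochizuki2012, Prop 3.4 (ii) p.92] -/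
theorem exists_Fcns_equivalence_of_iso (h : E.IsConjStable E.constantMonoid) (h' : E'.IsConjStable E'.constantMonoid) :
    ∃ F : E.Fcns h ⥤ E'.Fcns h', F.IsEquivalence ∧
      F ⋙ ModelFrobenioid.baseFunctor (E'.constantCovering h').divisorFunctor (E'.constantCovering h').ratFnFunctor
          (E'.constantCovering h').divB =
        ModelFrobenioid.baseFunctor (E.constantCovering h).divisorFunctor (E.constantCovering h).ratFnFunctor
          (E.constantCovering h).divB ⋙ CosetCat.pull σ.symm.toMonoidHom σ.symm.continuous σ.symm.surjective := by
  obtain ⟨ψ, hψ⟩ := I.exists_submonoidEquiv_of_map_eq (S := E.constantMonoid) (S' := E'.constantMonoid) I.map_constantMonoid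
  have hequiv : ∀ (g : P) (x : (E.constantCovering h).O),
      ψ ((E.constantCovering h).act g x) = (E'.constantCovering h').act (σ g) (ψ x) := by
    intro g x
    apply Subtype.ext
    rw [hψ, CoveringMonoid.coe_restrictAct_apply, CoveringMonoid.coe_restrictAct_apply, I.map_conj, hσ, hψ]
  exact ⟨CoveringMonoid.frobenioidMapOfPairIso (M := E.constantCovering h) (M' := E'.constantCovering h') σ ψ hequiv,
    CoveringMonoid.frobenioidMapOfPairIso_isEquivalence (M := E.constantCovering h) (M' := E'.constantCovering h') σ ψ hequiv,
    CoveringMonoid.frobenioidMapOfPairIso_comp_baseFunctor (M := E.constantCovering h) (M' := E'.constantCovering h')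
      σ ψ hequiv⟩

include hσ in
/-- `F_cns(M^Θ_*(Π_v)) ≌ F_cns(M^Θ_*(†F_v))`. [cite: Mochizuki2012, II Def 3.8 (i) p.113] -/
theorem nonempty_Fcns_equivalence_of_iso (h : E.IsConjStable E.constantMonoid) (h' : E'.IsConjStable E'.constantMonoid) :
    Nonempty (E.Fcns h ≌ E'.Fcns h') := by
  obtain ⟨F, hF, -⟩ := I.exists_Fcns_equivalence_of_iso σ hσ h h'
  haveI := hF
  exact ⟨F.asEquivalence⟩

/-! ### 3. The Frobenioids of stable submonoids (theta monoids `Ψ^ι_env`) along an isomorphism (Prop 3.4 (i) / Def 3.8 (ii)) -/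

include hσ in
/-- The subgroup `Q ≤ Π_X(M^Θ_*(Π_v))` and its image `σ(Q) ≤ Π_X(M^Θ_*(†F_v))` are isomorphic topological groups along `σ`
(print's `G_v(M^Θ_*(Π_v)▶) ⥲ G_v(M^Θ_*(†F_v)▶)`). [cite: Mochizuki2012, Prop 3.4 (i) p.91] -/
theorem exists_subgroup_continuousMulEquiv (Q : Subgroup P) :
    ∃ τ : Q ≃ₜ* Q.map (I.phi : P →* P'), ∀ g : Q, ((τ g : Q.map (I.phi : P →* P')) : P') = σ g := by
  have hmem : ∀ a : P, a ∈ Q ↔ σ a ∈ Q.map (I.phi : P →* P') := by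
    intro a
    rw [hσ]
    constructor
    · exact fun ha => Subgroup.mem_map_of_mem _ ha
    · rintro ⟨b, hb, hba⟩
      rwa [← I.phi.injective hba]
  exact ⟨{ toFun := fun s => ⟨σ s.1, (hmem s.1).1 s.2⟩
           invFun := fun t => ⟨σ.symm t.1, (hmem _).2 (by rw [ContinuousMulEquiv.apply_symm_apply]; exact t.2)⟩
           left_inv := fun s => Subtype.ext (σ.symm_apply_apply s.1)
           right_inv := fun t => Subtype.ext (σ.apply_symm_apply t.1)
           map_mul' := fun _ _ => Subtype.ext (map_mul σ _ _)
           continuous_toFun := (σ.continuous.comp continuous_subtype_val).subtype_mk _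
           continuous_invFun := (σ.symm.continuous.comp continuous_subtype_val).subtype_mk _ }, fun _ => rfl⟩

include hσ in
/-- **Frobenioids of stable submonoids along an isomorphism of theta-environment data.**  For a subgroup `Q` acting on a
`Q`-stable submonoid `S ⊆ lim_J H¹(…)` (print: `G_v(M^Θ_*▶) ↷ Ψ^ι_env(M^Θ_*)`, Def 3.8 (ii)) and the image data `σ(Q) ↷ S'`,
`S' = I.e(S)`, there is a functor `F(Q ↷ S) ⥤ F(σ(Q) ↷ S')` (THIS seat's `frobenioidMapOfPairIso`) which is an EQUIVALENCE and lies
over the base change `𝓑(Q)⁰ → 𝓑(σ(Q))⁰` on the nose. [cite: Mochizuki2012, Prop 3.4 (i) p.91] -/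
theorem exists_frobenioidOfStable_equivalence_of_map_eq {S : Submonoid E.H} {S' : Submonoid E'.H} (Q : Subgroup P)
    (hmap : S.map (I.e : E.H →* E'.H) = S') (hS : ∀ (g : Q) (x : E.H), x ∈ S → E.conj g x ∈ S)
    (hS' : ∀ (g : Q.map (I.phi : P →* P')) (x : E'.H), x ∈ S' → E'.conj g x ∈ S') :
    ∃ (τ : Q ≃ₜ* Q.map (I.phi : P →* P')) (F : E.frobenioidOfStable S Q hS ⥤ E'.frobenioidOfStable S' _ hS'),
      (∀ g : Q, ((τ g : Q.map (I.phi : P →* P')) : P') = σ g) ∧ F.IsEquivalence ∧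
      F ⋙ ModelFrobenioid.baseFunctor (E'.coveringOfStable S' _ hS').divisorFunctor (E'.coveringOfStable S' _ hS').ratFnFunctor
          (E'.coveringOfStable S' _ hS').divB =
        ModelFrobenioid.baseFunctor (E.coveringOfStable S Q hS).divisorFunctor (E.coveringOfStable S Q hS).ratFnFunctor
          (E.coveringOfStable S Q hS).divB ⋙ CosetCat.pull τ.symm.toMonoidHom τ.symm.continuous τ.symm.surjective := by
  obtain ⟨ψ, hψ⟩ := I.exists_submonoidEquiv_of_map_eq hmap
  obtain ⟨τ, hτ⟩ := I.exists_subgroup_continuousMulEquiv σ hσ Q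
  have hequiv : ∀ (g : Q) (x : (E.coveringOfStable S Q hS).O),
      ψ ((E.coveringOfStable S Q hS).act g x) = (E'.coveringOfStable S' _ hS').act (τ g) (ψ x) := by
    intro g x
    apply Subtype.ext
    rw [hψ, CoveringMonoid.coe_restrictAct_apply, CoveringMonoid.coe_restrictAct_apply, MonoidHom.comp_apply,
      MonoidHom.comp_apply, Subgroup.subtype_apply, Subgroup.subtype_apply, hτ, I.map_conj, hσ, hψ]
  exact ⟨τ, CoveringMonoid.frobenioidMapOfPairIso (M := E.coveringOfStable S Q hS) (M' := E'.coveringOfStable S' _ hS') τ ψ hequiv,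
    hτ, CoveringMonoid.frobenioidMapOfPairIso_isEquivalence (M := E.coveringOfStable S Q hS)
      (M' := E'.coveringOfStable S' _ hS') τ ψ hequiv,
    CoveringMonoid.frobenioidMapOfPairIso_comp_baseFunctor (M := E.coveringOfStable S Q hS)
      (M' := E'.coveringOfStable S' _ hS') τ ψ hequiv⟩

include hσ in
/-- **`F^ι_env(M^Θ_*(Π_v)) ≌ F^{ι'}_env(M^Θ_*(†F_v))`** (Def 3.8 (ii) along Prop 3.4 (i)): the theta monoid `Ψ^ι_env` is carried onto
`Ψ^{ι'}_env`, `ι' = I.iota ι` (abc-iut-L6-t2's `Iso.map_thetaMonoid`), so the Frobenioids of `Q ↷ Ψ^ι_env` and `σ(Q) ↷ Ψ^{ι'}_env` are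
equivalent. [cite: Mochizuki2012, II Def 3.8 (ii) p.113] -/
theorem nonempty_thetaMonoid_frobenioid_equivalence_of_iso (Q : Subgroup P) (ι : E.Iota)
    (hS : ∀ (g : Q) (x : E.H), x ∈ E.thetaMonoid ι → E.conj g x ∈ E.thetaMonoid ι)
    (hS' : ∀ (g : Q.map (I.phi : P →* P')) (x : E'.H), x ∈ E'.thetaMonoid (I.iota ι) → E'.conj g x ∈ E'.thetaMonoid (I.iota ι)) :
    Nonempty (E.frobenioidOfStable (E.thetaMonoid ι) Q hS ≌
      E'.frobenioidOfStable (E'.thetaMonoid (I.iota ι)) (Q.map (I.phi : P →* P')) hS') := by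
  obtain ⟨τ, F, -, hF, -⟩ := I.exists_frobenioidOfStable_equivalence_of_map_eq σ hσ Q (I.map_thetaMonoid ι) hS hS'
  haveI := hF
  exact ⟨F.asEquivalence⟩

omit [TopologicalSpace P] [TopologicalSpace P'] in
/-- Stability transports along the isomorphism: if `Q` stabilises `S` then `σ(Q) = I.phi(Q)` stabilises `I.e(S)` (so the
hypothesis `hS'` above is available from `hS`). [cite: Mochizuki2012, Prop 3.4 (i) p.91] -/
theorem stable_map_of_stable {S : Submonoid E.H} (Q : Subgroup P) (hS : ∀ (g : Q) (x : E.H), x ∈ S → E.conj g x ∈ S) :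
    ∀ (g : Q.map (I.phi : P →* P')) (x : E'.H), x ∈ S.map (I.e : E.H →* E'.H) → E'.conj g x ∈ S.map (I.e : E.H →* E'.H) := by
  rintro ⟨g', hg'⟩ y hy
  obtain ⟨g, hg, rfl⟩ := Subgroup.mem_map.1 hg'
  obtain ⟨x, hx, rfl⟩ := Submonoid.mem_map.1 hy
  refine Submonoid.mem_map.2 ⟨E.conj g x, hS ⟨g, hg⟩ x hx, ?_⟩
  change I.e (E.conj g x) = E'.conj (I.phi g) (I.e x)
  exact I.map_conj g x

end TemperedThetaMonoids.ThetaEnvData.Iso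

end Literature.IUT.HodgeArakelov

end
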